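import Summits.BirchSwinnertonDyer.BirchSwinnertonDyer.Theorems.TwinTransportX9RungSchemaTwoStep
import Literature.NumberTheory.EllipticCurves.GlobalMinimalModelProofs
import Literature.NumberTheory.QuadraticFields.FundamentalDiscriminant

/-!
# Route `TwinTransportX9` — crux `TrivialTwinSupplyX9` (item 24080): EVERY admissible frame carries the cheap
conjuncts, and the crux REDUCES CLASS-WIDE to a pure L-value statement plus the Ш-certificate

Sequel to `TwinTransportX9FrameSupply` (frames exist for every pair). Here:

* `exists_quadraticField_of_bcsAdmissiblePair` — every admissible `d_K` (negative, square-free, `≡ 1 (mod 4)`)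
  is a field discriminant (`Quadratic.exists_numberField_discr_eq`), so the transport lemma
  `classX9_and_not_dvd_tamagawaProduct_of_frame` applies to EVERY admissible frame, not only to the frames the
  prescribed-splitting construction produces.
* `frameTransport_classX9` (**∀ pairs, ∀ admissible frames, ∀ minimal twins**): if `(W, p)` is an X9 pair with
  `p ∤ ∏ c_ℓ(W)`, `(d_K, d_F)` is BCS-admissible and `C • W₁ = W^{(d_K)}` with `W₁` globally minimal, then
  `ClassX9 W₁ p ∧ p ∤ ∏ c_ℓ(W₁) ∧ p ∤ #W₁(ℚ)_tors`; `frameTwin_classX9` adds Néron's minimal model. Two steps: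
  `frameTransport₂_classX9`.
* `trivialTwinSupplyX9_of_unitValueSupply` (**class-wide reduction**): the crux follows from
  (S1″) a PURELY ANALYTIC unit-value supply — every X9 pair with `p ∤ ∏ c_ℓ` has an admissible frame whose
  minimal twin `W₁` has `r_an(W₁) = 0` and `L(W₁,1)/Ω(W₁) ∈ ℤ_(p)^×`, or a second admissible step with that
  property (NO Tamagawa / torsion / Ш clauses) — together with (S2) "`p ∤ #Ш` at an X9 curve of analytic rank
  `0` with `p ∤ ∏ c_ℓ · #tors` and unit `L`-value" (verbatim the registered stub `stub_shaUnitOfUnitTwinX9` of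
  the crux's birth skeleton). Conversely `unitValueSupply_of_trivialTwinSupplyX9`: the crux implies (S1″). So,
  modulo the Kolyvagin-type certificate (S2), the crux IS the statement (S1″) about the values
  `L(W^{(d)},1)/Ω` along an explicit infinite congruence family of quadratic twists — the form in which it is a
  named open problem (Prasanna 2010, p. 400: non-vanishing mod `p` of toric/quadratic-twist `L`-values beyond
  the (sur)/(im) hypotheses). The registered skeleton's (S1) carried the Tamagawa/torsion clauses; they are
  discharged here in the kernel for all pairs and all frames.

HONEST FRAMING: BSD is NOT proved; `TrivialTwinSupplyX9` is NOT proved; (S1″) and (S2) are hypotheses (binders),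
not facts. Helper theorems (`--supports` item 24080); 0 definitions, 0 named facts, 0 sorry. References:
[BurungaleCastellaSkinner2025] §1.2, Prop. 5.2.1, Lemma 5.2.3; [JetchevSkinnerWan2017] §7.3.1;
[Prasanna2010CJM] p. 400; [MatarNekovar2019] Thm. 0.3; [Marcus1977] Ch. 2 Thm. 1.
-/

set_option linter.dupNamespace false
set_option autoImplicit false

noncomputable section

open scoped Classical NumberField

open WeierstrassCurve Literature.NumberTheory.EllipticCurves
  Summit.BirchSwinnertonDyer.BirchSwinnertonDyer.Rank1Residual
  Summit.BirchSwinnertonDyer.BirchSwinnertonDyer.Theses.TwinTransportX9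
  Literature.NumberTheory.QuadraticFields.Quadratic

namespace Summit.BirchSwinnertonDyer.BirchSwinnertonDyer.Theorems.TwinTransportX9Rung

/-! ## §1 Every admissible `d_K` is a field discriminant -/

/-- The `K`-side of a BCS-admissible pair is a (negative) fundamental discriminant `≡ 1 (mod 4)`, hence the
discriminant of a quadratic field (Marcus Ch. 2 Thm. 1, `Quadratic.exists_numberField_discr_eq`).
[cite: Marcus1977, Ch. 2, Thm. 1] [cite: BurungaleCastellaSkinner2025, §1.2 (disc)] -/
theorem exists_quadraticField_of_bcsAdmissiblePair {W : WeierstrassCurve ℚ} [W.IsElliptic]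
    [W.IsGloballyMinimal] {p : ℕ} {dK dF : ℤ} (hadm : BCSAdmissiblePair W p dK dF) :
    ∃ (K₀ : Type) (_ : Field K₀) (_ : NumberField K₀),
      Module.finrank ℚ K₀ = 2 ∧ NumberField.discr K₀ = dK :=
  exists_numberField_discr_eq (Or.inl ⟨hadm.1.2.2.1, hadm.1.2.1, by have := hadm.1.1; omega⟩)

/-! ## §2 Transport along EVERY admissible frame -/

/-- **∀-frame transport of the cheap conjuncts.** For every X9 pair `(W, p)` with `p ∤ ∏ c_ℓ(W)`, EVERY
BCS-admissible frame `(d_K, d_F)` and EVERY globally minimal `W₁` with `C • W₁ = W^{(d_K)}`: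
`ClassX9 W₁ p` (twist stability), `p ∤ ∏ c_ℓ(W₁)` (Jetchev–Skinner–Wan (eq:tamK) over `ℚ(√d_K)`, bad-prime clause
vacuous by (Heeg)) and `p ∤ #W₁(ℚ)_tors` (irreducibility of `ρ̄_{W₁,p}`). BSD is NOT proved.
[cite: JetchevSkinnerWan2017, §7.3.1 (eq:tamK)] [cite: BurungaleCastellaSkinner2025, §1.2, Prop. 5.2.1] -/
theorem frameTransport_classX9 (W : WeierstrassCurve ℚ) [W.IsElliptic] [W.IsGloballyMinimal]
    (p : ℕ) [Fact p.Prime] (hX9 : ClassX9 W p) (hTam : ¬ p ∣ W.tamagawaProduct)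
    {dK dF : ℤ} (hadm : BCSAdmissiblePair W p dK dF)
    (W₁ : WeierstrassCurve ℚ) [W₁.IsElliptic] [W₁.IsGloballyMinimal] {C : VariableChange ℚ}
    (hC : C • W₁ = W.quadraticTwist (dK : ℚ)) :
    ClassX9 W₁ p ∧ ¬ p ∣ W₁.tamagawaProduct ∧ ¬ p ∣ W₁.torsionOrder := by
  have hp : p.Prime := Fact.out
  obtain ⟨K₀, _, _, hK₀2, hK₀d⟩ := exists_quadraticField_of_bcsAdmissiblePair hadm
  obtain ⟨hX9₁, hTam₁⟩ := classX9_and_not_dvd_tamagawaProduct_of_frame W hadm hK₀2 hK₀d W₁ hC hX9 hTam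
  exact ⟨hX9₁, hTam₁, not_dvd_of_padicValNat_eq_zero hp W₁.torsionOrder_pos_holds
    (Rank1Residual.padicValNat_torsionOrder_eq_zero_of_irreducible _ p hX9₁.2.2.2.2.1)⟩

/-- **∀-frame minimal twin with the cheap conjuncts.** For every X9 pair with `p ∤ ∏ c_ℓ(W)` and EVERY admissible
frame: a globally minimal elliptic `W₁` with `C • W₁ = W^{(d_K)}` (Néron) and `ClassX9 W₁ p ∧ p ∤ ∏ c_ℓ(W₁) ∧
p ∤ #W₁(ℚ)_tors`. [cite: SilvermanAEC2009, VIII.8 Cor. 8.3] [cite: JetchevSkinnerWan2017, §7.3.1 (eq:tamK)] -/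
theorem frameTwin_classX9 (W : WeierstrassCurve ℚ) [W.IsElliptic] [W.IsGloballyMinimal]
    (p : ℕ) [Fact p.Prime] (hX9 : ClassX9 W p) (hTam : ¬ p ∣ W.tamagawaProduct)
    {dK dF : ℤ} (hadm : BCSAdmissiblePair W p dK dF) :
    ∃ (W₁ : WeierstrassCurve ℚ) (_ : W₁.IsElliptic) (_ : W₁.IsGloballyMinimal),
      (∃ C : WeierstrassCurve.VariableChange ℚ, C • W₁ = W.quadraticTwist (dK : ℚ)) ∧
      ClassX9 W₁ p ∧ ¬ p ∣ W₁.tamagawaProduct ∧ ¬ p ∣ W₁.torsionOrder := by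
  have hdQ : (dK : ℚ) ≠ 0 := by exact_mod_cast hadm.1.1.ne
  haveI iT : (W.quadraticTwist (dK : ℚ)).IsElliptic := isElliptic_quadraticTwist _ hdQ
  obtain ⟨C, hC⟩ := hasGlobalMinimalModel_rat_holds (W.quadraticTwist (dK : ℚ))
  haveI := hC
  have hCW : C⁻¹ • (C • W.quadraticTwist (dK : ℚ)) = W.quadraticTwist (dK : ℚ) := inv_smul_smul C _
  exact ⟨C • W.quadraticTwist (dK : ℚ), inferInstance, hC, ⟨C⁻¹, hCW⟩,
    frameTransport_classX9 W p hX9 hTam hadm _ hCW⟩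

/-- **Two admissible steps transport the cheap conjuncts** (the second-disjunct shape of the crux): along
`W ↦ W₁ ≅ W^{(d_K)} ↦ W₂ ≅ W₁^{(d_K')}` with both frames admissible, `ClassX9 W₂ p ∧ p ∤ ∏ c_ℓ(W₂) ∧ p ∤ #W₂(ℚ)_tors`.
[cite: JetchevSkinnerWan2017, §7.3.1 (eq:tamK)] [cite: BurungaleCastellaSkinner2025, §1.2, Prop. 5.2.1] -/
theorem frameTransport₂_classX9 (W : WeierstrassCurve ℚ) [W.IsElliptic] [W.IsGloballyMinimal]
    (p : ℕ) [Fact p.Prime] (hX9 : ClassX9 W p) (hTam : ¬ p ∣ W.tamagawaProduct)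
    {dK dF : ℤ} (hadm : BCSAdmissiblePair W p dK dF)
    (W₁ : WeierstrassCurve ℚ) [W₁.IsElliptic] [W₁.IsGloballyMinimal] {C : VariableChange ℚ}
    (hC : C • W₁ = W.quadraticTwist (dK : ℚ))
    {dK' dF' : ℤ} (hadm' : BCSAdmissiblePair W₁ p dK' dF')
    (W₂ : WeierstrassCurve ℚ) [W₂.IsElliptic] [W₂.IsGloballyMinimal] {C' : VariableChange ℚ}
    (hC' : C' • W₂ = W₁.quadraticTwist (dK' : ℚ)) :
    ClassX9 W₂ p ∧ ¬ p ∣ W₂.tamagawaProduct ∧ ¬ p ∣ W₂.torsionOrder := by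
  obtain ⟨hX9₁, hTam₁, -⟩ := frameTransport_classX9 W p hX9 hTam hadm W₁ hC
  exact frameTransport_classX9 W₁ p hX9₁ hTam₁ hadm' W₂ hC'

/-! ## §3 The class-wide reduction of the crux to (S1″) unit-value supply + (S2) the Ш-certificate -/

/-- **CLASS-WIDE REDUCTION: `TrivialTwinSupplyX9` ⇐ (S1″) ∧ (S2).** (S1″) is purely analytic — an admissible frame
(or two admissible steps) reaching a minimal twin of analytic rank `0` with `L/Ω` a rational `p`-adic unit, for
every X9 pair with `p ∤ ∏ c_ℓ`; (S2) is the registered stub `stub_shaUnitOfUnitTwinX9` verbatim. The Tamagawa and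
torsion clauses of the crux are supplied for every frame by `frameTransport_classX9`. Nothing is proved about
(S1″) or (S2): they are the binders. BSD is NOT proved; the crux is NOT proved.
[cite: Prasanna2010CJM, p. 400 (Introduction)] [cite: MatarNekovar2019, Theorem 0.3]
[cite: BurungaleCastellaSkinner2025, §1.2, Prop. 5.2.1] -/
theorem trivialTwinSupplyX9_of_unitValueSupply
    (hS1 : ∀ (W : WeierstrassCurve ℚ) [W.IsElliptic] [W.IsGloballyMinimal] (p : ℕ) [Fact p.Prime],
      ClassX9 W p → ¬ p ∣ W.tamagawaProduct →
      ∃ dK dF : ℤ, BCSAdmissiblePair W p dK dF ∧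
        ∃ (W₁ : WeierstrassCurve ℚ) (_ : W₁.IsElliptic) (_ : W₁.IsGloballyMinimal),
          (∃ C : WeierstrassCurve.VariableChange ℚ, C • W₁ = W.quadraticTwist (dK : ℚ)) ∧
          ((W₁.analyticRank = 0 ∧
              ∃ q : ℚ, W₁.leadingLCoeff / (W₁.realPeriodRat : ℂ) = (q : ℂ) ∧ padicValRat p q = 0) ∨
            ∃ dK' dF' : ℤ, BCSAdmissiblePair W₁ p dK' dF' ∧
              ∃ (W₂ : WeierstrassCurve ℚ) (_ : W₂.IsElliptic) (_ : W₂.IsGloballyMinimal),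
                (∃ C : WeierstrassCurve.VariableChange ℚ, C • W₂ = W₁.quadraticTwist (dK' : ℚ)) ∧
                W₂.analyticRank = 0 ∧
                ∃ q : ℚ, W₂.leadingLCoeff / (W₂.realPeriodRat : ℂ) = (q : ℂ) ∧ padicValRat p q = 0))
    (hS2 : ∀ (W' : WeierstrassCurve ℚ) [W'.IsElliptic] [W'.IsGloballyMinimal] (p : ℕ) [Fact p.Prime],
      ClassX9 W' p → W'.analyticRank = 0 → ¬ p ∣ W'.tamagawaProduct → ¬ p ∣ W'.torsionOrder →
      (∃ q : ℚ, W'.leadingLCoeff / (W'.realPeriodRat : ℂ) = (q : ℂ) ∧ padicValRat p q = 0) →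
      ¬ p ∣ W'.shaOrder) :
    TrivialTwinSupplyX9 := by
  intro W _ _ p _ hX9 hTam
  obtain ⟨dK, dF, hadm, W₁, i₁, i₁', ⟨C, hC⟩, hcase⟩ := hS1 W p hX9 hTam
  haveI := i₁; haveI := i₁'
  obtain ⟨hX9₁, hTam₁, htors₁⟩ := frameTransport_classX9 W p hX9 hTam hadm W₁ hC
  refine ⟨dK, dF, hadm, W₁, i₁, i₁', ⟨C, hC⟩, ?_⟩
  rcases hcase with ⟨hr, hq⟩ | ⟨dK', dF', hadm', W₂, i₂, i₂', ⟨C', hC'⟩, hr, hq⟩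
  · exact Or.inl ⟨hr, hS2 W₁ p hX9₁ hr hTam₁ htors₁ hq, hTam₁, htors₁, hq⟩
  · haveI := i₂; haveI := i₂'
    obtain ⟨hX9₂, hTam₂, htors₂⟩ := frameTransport_classX9 W₁ p hX9₁ hTam₁ hadm' W₂ hC'
    exact Or.inr ⟨dK', dF', hadm', W₂, i₂, i₂', ⟨C', hC'⟩, hr, hS2 W₂ p hX9₂ hr hTam₂ htors₂ hq,
      hTam₂, htors₂, hq⟩

/-- **Converse bookkeeping: the crux implies (S1″)** (drop the Ш/Tamagawa/torsion conjuncts). With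
`trivialTwinSupplyX9_of_unitValueSupply`: modulo (S2), `TrivialTwinSupplyX9` is EQUIVALENT to the pure
`L`-value statement (S1″). BSD is NOT proved. [cite: Prasanna2010CJM, p. 400 (Introduction)] -/
theorem unitValueSupply_of_trivialTwinSupplyX9 (h : TrivialTwinSupplyX9)
    (W : WeierstrassCurve ℚ) [W.IsElliptic] [W.IsGloballyMinimal] (p : ℕ) [Fact p.Prime]
    (hX9 : ClassX9 W p) (hTam : ¬ p ∣ W.tamagawaProduct) :
    ∃ dK dF : ℤ, BCSAdmissiblePair W p dK dF ∧
      ∃ (W₁ : WeierstrassCurve ℚ) (_ : W₁.IsElliptic) (_ : W₁.IsGloballyMinimal),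
        (∃ C : WeierstrassCurve.VariableChange ℚ, C • W₁ = W.quadraticTwist (dK : ℚ)) ∧
        ((W₁.analyticRank = 0 ∧
            ∃ q : ℚ, W₁.leadingLCoeff / (W₁.realPeriodRat : ℂ) = (q : ℂ) ∧ padicValRat p q = 0) ∨
          ∃ dK' dF' : ℤ, BCSAdmissiblePair W₁ p dK' dF' ∧
            ∃ (W₂ : WeierstrassCurve ℚ) (_ : W₂.IsElliptic) (_ : W₂.IsGloballyMinimal),
              (∃ C : WeierstrassCurve.VariableChange ℚ, C • W₂ = W₁.quadraticTwist (dK' : ℚ)) ∧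
              W₂.analyticRank = 0 ∧
              ∃ q : ℚ, W₂.leadingLCoeff / (W₂.realPeriodRat : ℂ) = (q : ℂ) ∧ padicValRat p q = 0) := by
  obtain ⟨dK, dF, hadm, W₁, i₁, i₁', hC, hcase⟩ := h W p hX9 hTam
  refine ⟨dK, dF, hadm, W₁, i₁, i₁', hC, ?_⟩
  rcases hcase with ⟨hr, -, -, -, hq⟩ | ⟨dK', dF', hadm', W₂, i₂, i₂', hC', hr, -, -, -, hq⟩
  · exact Or.inl ⟨hr, hq⟩
  · exact Or.inr ⟨dK', dF', hadm', W₂, i₂, i₂', hC', hr, hq⟩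

end Summit.BirchSwinnertonDyer.BirchSwinnertonDyer.Theorems.TwinTransportX9Rung
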